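import Literature.Computability.AlgebraicComplexity.HomogeneousCircuits
import Literature.Computability.AlgebraicComplexity.CircuitDepthProductDepthOne

/-!
# Homogeneous `ΣΠ` circuits — discharge of `homProductDepthCircuitSize_ne_top`

Discharge (D-0014) of the named fact
`Literature.Computability.AlgebraicComplexity.homProductDepthCircuitSize_ne_top`
(`HomogeneousCircuits.lean`): for `Δ ≥ 1` and a homogeneous polynomial `f`, the homogeneous
product-depth-`Δ` circuit size `homProductDepthCircuitSize Δ f` is finite. Source: N. Limaye,
S. Srinivasan, S. Tavenas, *Superpolynomial lower bounds against low-depth algebraic circuits*,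
FOCS 2021 / J. ACM 72 (2025) Art. 26 (section, lemma and page numbers below are those of the
J. ACM version) — §1 (p. 26:2: "the product-depth of the circuit … is the maximum number of
product gates on a root-to-leaf path"; p. 26:3: "a … homogeneous circuit is one where each
internal node computes a … homogeneous polynomial") and the `ΣΠ` case in the proof of Lemma 19
(p. 26:16: polynomials "computed as linear combinations of monomials. In particular each monomial
being homogeneous, … we directly get a homogeneous circuit of product-depth 1").

The printed argument, in the tree's list-based model `ArithCircuit` (`ArithCircuit.lean`,
`CircuitDepth.lean`): the `ΣΠ` **sum-of-monomials circuit** `ArithCircuit.sumOfMonomials ms f` of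
`CircuitDepthProductDepthOne.lean` — one product gate `∏ X i = Xᵐ` per monomial `m` of an
enumeration `ms` of the support of `f` (the layer `DepthReduction.layerM` of the `ΣΠΣΠ` builder of
`DepthReductionProofs.lean`) followed by ONE weighted-sum gate `∑ₘ coeff m f • [Xᵐ]`
(`DepthReduction.pieceGate`), the output — is already known there to compute `f`, to have
product-depth `≤ 1` and `#ms + 1` gates. This file adds the homogeneity bookkeeping: its gate
values are the monomials `Xᵐ`, `m ∈ ms`, and `f` itself (`ArithCircuit.gateValues_sumOfMonomials`),
so it is a homogeneous circuit (`ArithCircuit.IsHomogeneousCircuit`: every gate value is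
homogeneous) as soon as `f` is homogeneous (`ArithCircuit.isHomogeneousCircuit_sumOfMonomials`;
monomials are homogeneous — exactly the printed remark). Consequences:
`homProductDepthCircuitSize_le_card_support_add_one` (`homProductDepthCircuitSize Δ f ≤ #supp f + 1`
for `Δ ≥ 1`, `f` homogeneous) and the discharge `homProductDepthCircuitSize_ne_top_holds`.

No finiteness of the variable type and no hypothesis on the coefficient semiring is needed. The
inhomogeneous-model analogues (`ArithCircuit.exists_computes_productDepth_one_holds`,
`productDepthCircuitSize_ne_top_holds`) are in `CircuitDepthProductDepthOne.lean`.

## References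

* N. Limaye, S. Srinivasan, S. Tavenas, *Superpolynomial lower bounds against low-depth algebraic
  circuits*, FOCS 2021, 804–814; J. ACM 72 (2025), Art. 26: §1 (pp. 26:2–3), proof of Lemma 19
  (p. 26:16).
* M. Kumar, S. Saraf, *On the power of homogeneous depth 4 arithmetic circuits*, SIAM J. Comput.
  46 (2017) 336–387, §1 (homogeneous circuits).
-/

noncomputable section

open MvPolynomial

namespace Literature.Computability.AlgebraicComplexity

universe u v

namespace ArithCircuit

variable {k : Type u} {σ : Type v} [CommSemiring k]

open DepthReduction

/-- The gate values of the sum-of-monomials circuit along an enumeration `ms` (without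
repetition) of a superset of the support of `f`: the monomials `Xᵐ`, `m ∈ ms` (in the order of
`ms`), followed by `f`. [cite: LimayeSrinivasanTavenas2021, proof of Lemma 19 (ΣΠ case)] -/
theorem gateValues_sumOfMonomials {ms : List (σ →₀ ℕ)} (hnd : ms.Nodup) {f : MvPolynomial σ k}
    (hf : ∀ m ∈ f.support, m ∈ ms) :
    gateValues (sumOfMonomials ms f).gates = (ms.map fun m => monomial m (1 : k)) ++ [f] := by
  classical
  change gateValues (layerM ms ++ [pieceGate ms f]) = _
  rw [gateValues_append_singleton, gateValues_layerM,
    eval_pieceGate ms hnd fun m hm => List.mem_toFinset.mpr (hf m hm)]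

/-- **The sum-of-monomials circuit of a homogeneous polynomial is a homogeneous circuit**: its
gate values are monomials (homogeneous) and `f` (LST: "each monomial being homogeneous, … we
directly get a homogeneous circuit of product-depth 1"). [cite: LimayeSrinivasanTavenas2021,
proof of Lemma 19 (ΣΠ case); KumarSaraf2017, §1] -/
theorem isHomogeneousCircuit_sumOfMonomials {ms : List (σ →₀ ℕ)} (hnd : ms.Nodup)
    {f : MvPolynomial σ k} (hms : ∀ m ∈ f.support, m ∈ ms) {e : ℕ} (hf : f.IsHomogeneous e) :
    (sumOfMonomials ms f).IsHomogeneousCircuit := by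
  intro g hg
  rw [gateValues_sumOfMonomials hnd hms] at hg
  simp only [List.mem_append, List.mem_map, List.mem_singleton] at hg
  rcases hg with ⟨m, -, rfl⟩ | rfl
  · exact ⟨_, isHomogeneous_monomial _ rfl⟩
  · exact ⟨e, hf⟩

end ArithCircuit

section Measures

variable {k : Type u} {σ : Type v} [CommSemiring k]

/-- For `Δ ≥ 1`, the HOMOGENEOUS product-depth-`Δ` size of a homogeneous `f` is at most
`#support f + 1`: the sum-of-monomials circuit of `f` along its support is a homogeneous circuit
of product-depth `≤ 1` with that many gates. [cite: LimayeSrinivasanTavenas2021, §1 and proof of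
Lemma 19 (ΣΠ case)] -/
theorem homProductDepthCircuitSize_le_card_support_add_one {Δ : ℕ} (hΔ : 1 ≤ Δ)
    {f : MvPolynomial σ k} {e : ℕ} (hf : f.IsHomogeneous e) :
    homProductDepthCircuitSize Δ f ≤ ((f.support.card + 1 : ℕ) : ℕ∞) := by
  have hms : ∀ m ∈ f.support, m ∈ f.support.toList := fun _ hm => Finset.mem_toList.mpr hm
  have h := homProductDepthCircuitSize_le
    (ArithCircuit.computes_sumOfMonomials (Finset.nodup_toList f.support) hms)
    ((ArithCircuit.productDepth_sumOfMonomials_le f.support.toList f).trans hΔ)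
    (ArithCircuit.isHomogeneousCircuit_sumOfMonomials (Finset.nodup_toList f.support) hms hf)
  rwa [ArithCircuit.size_sumOfMonomials, Finset.length_toList] at h

end Measures

/-- **Discharge** of the named fact `homProductDepthCircuitSize_ne_top` (`HomogeneousCircuits.lean`;
Limaye–Srinivasan–Tavenas 2021, §1 and proof of Lemma 19, `ΣΠ` case): for `Δ ≥ 1` and `f`
homogeneous, the sum-of-monomials circuit of `f` is a homogeneous circuit of product-depth `≤ 1`
computing `f`, so `homProductDepthCircuitSize Δ f ≠ ⊤`. Holds over every commutative semiring and
every type of variables. [cite: LimayeSrinivasanTavenas2021, §1 and proof of Lemma 19 (ΣΠ case)] -/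
theorem homProductDepthCircuitSize_ne_top_holds : homProductDepthCircuitSize_ne_top.{u, v} := by
  intro k σ _ Δ hΔ f e hf
  exact ne_top_of_le_ne_top (ENat.coe_ne_top _)
    (homProductDepthCircuitSize_le_card_support_add_one hΔ hf)

end Literature.Computability.AlgebraicComplexity

end
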